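import Summits.MatrixMultiplication.MatrixMultiplication.Theorems.OutsiderSandwichToricCeilingPowThreeCwBaseData1

/-!
# OutsiderSandwich — toric ceiling of `cw₂^{⊠N}`: the `N = 3` three-cw base, PAIR census 1A
(group `cZ1`, part A of 2: 300 of 600 instances; decomp-mm lens 4, gen 47, kernel K47-9 census;
THESES-FREE, `ω`-free; helper toward `LaserTangency`, stmt-32268)

LABEL.  TORIC · FINITE (`N = 3`) · NEC-side instrument.  In CHUNKS of at most 60 instances (kernel
memory / time ceiling on the gate): the certificate pair `datc1[i]` satisfies `goodP₁` for the
instance `(instOf₁ cZ1)[i]` — both decode to `valid₁` perfect matchings of `cw ⊠ cw ⊠ cw` minus the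
instance and the second misses a row of the first (`census₃_1_r`, `decide +kernel`, standard axioms;
no `native_decide`, no `ofReduceBool`).  Consumed by
`…ThreeCwBase`.
WHAT THIS IS NOT: no statement about tensors or `ω`.
-/

set_option linter.dupNamespace false
set_option maxRecDepth 200000
set_option Elab.async false

namespace Summit.MatrixMultiplication.MatrixMultiplication.Theorems.OutsiderSandwichToricCeilingPowThreeCwBaseCensus1A

open Summit.MatrixMultiplication.MatrixMultiplication.Theorems.OutsiderSandwichToricCeilingPowTwoCwBaseDefs
open Summit.MatrixMultiplication.MatrixMultiplication.Theorems.OutsiderSandwichToricCeilingPowThreeCwBaseDefs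
open Summit.MatrixMultiplication.MatrixMultiplication.Theorems.OutsiderSandwichToricCeilingPowThreeCwBaseData1

set_option maxHeartbeats 0 in
/-- Group `cZ1`: the certificate list has the length of the instance list (600). -/
theorem lenc1 : (instOf₁ cZ1).length = datc1.length := by
  decide +kernel

/-- Group `cZ1`: number of certificate pairs. -/
theorem dlenc1 : datc1.length = 600 := by
  decide +kernel

set_option maxHeartbeats 0 in
/-- PAIR CENSUS, group `cZ1`, instances `0 … 59` (kernel-decided). -/
theorem census₃_1_0 : ((((instOf₁ cZ1).zip datc1).drop 0).take 60).all
    (fun p => goodP₁ p.1 p.2.1 p.2.2) = true := by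
  decide +kernel

set_option maxHeartbeats 0 in
/-- PAIR CENSUS, group `cZ1`, instances `60 … 119` (kernel-decided). -/
theorem census₃_1_1 : ((((instOf₁ cZ1).zip datc1).drop 60).take 60).all
    (fun p => goodP₁ p.1 p.2.1 p.2.2) = true := by
  decide +kernel

set_option maxHeartbeats 0 in
/-- PAIR CENSUS, group `cZ1`, instances `120 … 179` (kernel-decided). -/
theorem census₃_1_2 : ((((instOf₁ cZ1).zip datc1).drop 120).take 60).all
    (fun p => goodP₁ p.1 p.2.1 p.2.2) = true := by
  decide +kernel

set_option maxHeartbeats 0 in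
/-- PAIR CENSUS, group `cZ1`, instances `180 … 239` (kernel-decided). -/
theorem census₃_1_3 : ((((instOf₁ cZ1).zip datc1).drop 180).take 60).all
    (fun p => goodP₁ p.1 p.2.1 p.2.2) = true := by
  decide +kernel

set_option maxHeartbeats 0 in
/-- PAIR CENSUS, group `cZ1`, instances `240 … 299` (kernel-decided). -/
theorem census₃_1_4 : ((((instOf₁ cZ1).zip datc1).drop 240).take 60).all
    (fun p => goodP₁ p.1 p.2.1 p.2.2) = true := by
  decide +kernel

end Summit.MatrixMultiplication.MatrixMultiplication.Theorems.OutsiderSandwichToricCeilingPowThreeCwBaseCensus1A
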